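import Literature.Probability.Percolation.AnchoredIsoperimetricProfile
import HarnessLib

/-!
# The anchored isoperimetric profile of `C(0)`: elementary structure (proofs)

Sibling PROOFS file of `AnchoredIsoperimetricProfile.lean` (the definitions `IsValidSubgraph`,
`openEdgeBoundaryCard`, `anchoredProfile` and the named facts `CerfDembin2020_thm11`,
`CerfDembin2020_thm12`). Everything in this file is proved; there are no named facts. It
formalises the elementary, deterministic layer of

* [CerfDembin2020] R. Cerf, B. Dembin, *Vanishing of the anchored isoperimetric profile in bond
  percolation at `p_c`*, Electron. Commun. Probab. 25 (2020), §1 (the objects) and §2;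
* [Dembin2020] B. Dembin, *Existence of the anchored isoperimetric profile in supercritical bond
  percolation in dimension two and higher*, ALEA 17 (2020), §1,

on which the printed proofs of both theorems rest. The companion file
`AnchoredIsoperimetricProfileCutset.lean` continues with the deterministic core of the upper large
deviations of [Dembin2020, §4] and the Borel–Cantelli step of [Dembin2020, §1].

## Contents

* §1 Valid subgraphs: `{0}` is valid; a valid `H` lies inside `C(0)`; the whole cluster `C(0)`,
  when finite, is valid and has EMPTY open edge boundary ([CerfDembin2020, §2]: "if `H` is equal
  to `C(0)` … then `∂_{C(0)} H = ∂°H = ∅`"); conversely (for a lattice configuration) a valid `H`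
  with empty open edge boundary is all of `C(0)`.
* §2 Counting: `|∂° H| ≤ |∂ H| ≤ 2d |H|`.
* §3 The profile `φ̂_n` (`anchoredProfile d n`) is, for `n ≥ 1`, a minimum over a finite
  nonempty set of ratios: it is attained ([Dembin2020, §1]: "let `𝒢_n` be the set of the valid
  subgraphs that achieve the infimum in `φ_n`"), `0 ≤ φ̂_n ≤ 2d`, it is non-increasing in `n`,
  `φ̂_n = 0` as soon as `|C(0)| ≤ n^d` ([CerfDembin2020, §1]: "taking `H = C(0)`, we see that
  `φ̂_n(p)` is equal to `0`"), and `φ̂_n ≥ n^{-d} > 0` on `{C(0) infinite}` — the two halves of the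
  dichotomy "`lim n φ̂_n(p) = θ(p) δ_{φ(p)} + (1 - θ(p)) δ_0`" of [CerfDembin2020, §1].

## What is NOT here

`CerfDembin2020_thm11_holds` (Theorem 1.1, the a.s. limit `n φ̂_n(p) → φ(p) > 0` for `p > p_c`):
its printed proof ([Dembin2020], upper and lower large deviations + Borel–Cantelli) needs the flow
constant `β_p` (Rossignol–Théret), upper large deviations for maximal flows (Théret), Pisztora's
coarse graining, Zhang's smooth cutsets and the Wulff isoperimetric theory on Caccioppoli sets,
none of which is formalised in Mathlib or in this tree.

## Design

Graph-free where possible (`openGraph ω`, `openCluster`, `openConnIn`), the lattice `ℤ^d` entering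
through `edgeBoundary (zdGraph d)`; lemmas needing `ω ⊆ E(ℤ^d)` (true `P_p`-a.s.,
`ProbabilityTheory.setBernoulli_ae_subset`) say so. Imports: the definitions file only.
-/

noncomputable section

namespace Literature.Probability.Percolation

open Finset LatticeModels
open _root_.MeasureTheory _root_.Filter
open scoped _root_.Topology

variable {d : ℕ}

/-! ## §0 Two walk lemmas -/

section Walks

variable {V : Type*}

/-- A set of vertices containing the start of a walk and closed under the adjacency of the graph
contains the whole support of the walk. [folklore] -/
theorem support_subset_of_adj_closed {G : SimpleGraph V} {S : Set V}
    (hS : ∀ ⦃a b : V⦄, a ∈ S → G.Adj a b → b ∈ S) :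
    ∀ {u v : V} (p : G.Walk u v), u ∈ S → ∀ z ∈ p.support, z ∈ S
  | _, _, .nil, hu, z, hz => by
    rw [SimpleGraph.Walk.support_nil, List.mem_singleton] at hz
    exact hz ▸ hu
  | _, _, .cons h p, hu, z, hz => by
    rw [SimpleGraph.Walk.support_cons, List.mem_cons] at hz
    rcases hz with rfl | hz
    · exact hu
    · exact support_subset_of_adj_closed hS p (hS hu h) z hz

/-- Deleting edges from a configuration shrinks the open graph: `openGraph (ω ∖ Γ) ≤ openGraph ω`.
[folklore] -/
theorem openGraph_diff_le (ω Γ : BondConfig V) : openGraph (ω \ Γ) ≤ openGraph ω := by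
  intro a b h
  rw [openGraph_adj] at h ⊢
  exact ⟨h.1.1, h.2⟩

/-- An open walk from `x` all of whose vertices lie in `S` witnesses `{x ↔ y in S}`.
(Grimmett 1999, §1.3, open paths.) [folklore] -/
theorem mem_openConnIn_of_openWalk {ω : BondConfig V} {S : Set V} {x y : V}
    (p : (openGraph ω).Walk x y) (hS : ∀ z ∈ p.support, z ∈ S) : ω ∈ openConnIn S x y :=
  ⟨hS x p.start_mem_support, hS y p.end_mem_support, ⟨p.induce S hS⟩⟩

end Walks

/-- The open edge boundary `∂° H = ∂ H ∩ ω` is a finite set of edges.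
[cite: CerfDembin2020, §1 (∂_𝒢 A)] -/
theorem finite_edgeBoundary_inter (ω : BondConfig (Site d)) (H : Finset (Site d)) :
    (((↑(edgeBoundary (zdGraph d) H) : Set (Sym2 (Site d))) ∩ ω)).Finite :=
  (Finset.finite_toSet _).inter_of_left ω

/-! ## §1 Valid subgraphs -/

section Valid

variable (d) in
/-- `{0}` is a valid subgraph of `C(0)` (the trivial competitor, [CerfDembin2020, §1]).
[cite: CerfDembin2020, §1 (valid subgraph of C(0))] -/
theorem isValidSubgraph_singleton (ω : BondConfig (Site d)) :
    IsValidSubgraph d ω {0} := by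
  refine ⟨Finset.mem_singleton_self 0, fun x hx => ?_⟩
  rw [Finset.mem_singleton] at hx
  subst hx
  exact ⟨by simp, by simp, SimpleGraph.Reachable.refl _⟩

/-- A valid subgraph contains the origin. [cite: CerfDembin2020, §1 (valid subgraph of C(0))] -/
theorem IsValidSubgraph.zero_mem {ω : BondConfig (Site d)} {H : Finset (Site d)}
    (h : IsValidSubgraph d ω H) : (0 : Site d) ∈ H :=
  h.1

/-- A valid subgraph is nonempty. [cite: CerfDembin2020, §1 (valid subgraph of C(0))] -/
theorem IsValidSubgraph.card_pos {ω : BondConfig (Site d)} {H : Finset (Site d)}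
    (h : IsValidSubgraph d ω H) : 0 < H.card :=
  Finset.card_pos.2 ⟨0, h.1⟩

/-- A valid subgraph lies inside the open cluster of the origin: `H ⊆ C(0)`
([CerfDembin2020, §1]: "`0 ∈ H ⊂ C(0)`"). [cite: CerfDembin2020, §1 (valid subgraph of C(0))] -/
theorem IsValidSubgraph.subset_openCluster {ω : BondConfig (Site d)} {H : Finset (Site d)}
    (h : IsValidSubgraph d ω H) : (↑H : Set (Site d)) ⊆ openCluster ω 0 := by
  intro x hx
  obtain ⟨h0, hx', hr⟩ := h.2 x hx
  exact hr.map (SimpleGraph.Embedding.induce (↑H : Set (Site d))).toHom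

/-- Every vertex on an open walk from the origin lies in `C(0)`. [folklore] -/
theorem mem_openCluster_of_mem_support {ω : BondConfig (Site d)}
    {x z : Site d} (p : (openGraph ω).Walk 0 x) (hz : z ∈ p.support) : z ∈ openCluster ω 0 := by
  classical
  exact ⟨p.takeUntil z hz⟩

/-- **The whole cluster is a valid subgraph.** If `C(0)` is finite then `C(0)` (as a finset) is a
valid subgraph of `C(0)` ([CerfDembin2020, §1–§2]: "taking `H = C(0)`").
[cite: CerfDembin2020, §1 (valid subgraph of C(0))] -/
theorem isValidSubgraph_toFinset_openCluster {ω : BondConfig (Site d)}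
    (hC : (openCluster ω 0).Finite) : IsValidSubgraph d ω hC.toFinset := by
  classical
  refine ⟨by simp, fun x hx => ?_⟩
  rw [Set.Finite.mem_toFinset] at hx
  obtain ⟨p⟩ := hx
  refine mem_openConnIn_of_openWalk p fun z hz => ?_
  rw [Set.Finite.coe_toFinset]
  exact mem_openCluster_of_mem_support p hz

/-- **The cluster has no open boundary edge**: every open lattice edge with an endpoint in `C(0)`
has both endpoints in `C(0)`, so `∂_{C(0)} C(0) = ∂° C(0) = ∅` ([CerfDembin2020, §2]: "if `H`
is equal to `C(0)` … then `∂_{C(0)} H = ∂° H = ∅`"). [cite: CerfDembin2020, §2 (∂° C(0) = ∅)] -/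
theorem openEdgeBoundaryCard_toFinset_openCluster {ω : BondConfig (Site d)}
    (hC : (openCluster ω 0).Finite) : openEdgeBoundaryCard d ω hC.toFinset = 0 := by
  classical
  rw [openEdgeBoundaryCard, Set.ncard_eq_zero (finite_edgeBoundary_inter ω _),
    Set.eq_empty_iff_forall_notMem]
  rintro e ⟨he, heω⟩
  rw [Finset.mem_coe, mem_edgeBoundary_iff] at he
  obtain ⟨-, ⟨a, ha, hae⟩, ⟨b, hb, hbe⟩⟩ := he
  rw [Set.Finite.mem_toFinset] at ha hb
  have hne : a ≠ b := fun h => hb (h ▸ ha)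
  have heq : e = s(a, b) := (Sym2.mem_and_mem_iff hne).1 ⟨hae, hbe⟩
  subst heq
  exact hb (SimpleGraph.Reachable.trans ha
    (SimpleGraph.Adj.reachable ((openGraph_adj ω a b).2 ⟨heω, hne⟩)))

/-- Conversely, for a lattice configuration `ω ⊆ E(ℤ^d)`, a valid subgraph `H` with NO open
boundary edge is closed under open adjacency, hence contains the whole cluster: `C(0) ⊆ H`
(and so `C(0) = H` is finite). [cite: CerfDembin2020, §2 (∂° C(0) = ∅)] -/
theorem IsValidSubgraph.openCluster_subset_of_openEdgeBoundaryCard_eq_zero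
    {ω : BondConfig (Site d)} (hω : ω ⊆ (zdGraph d).edgeSet) {H : Finset (Site d)}
    (hH : IsValidSubgraph d ω H) (h0 : openEdgeBoundaryCard d ω H = 0) :
    openCluster ω 0 ⊆ (↑H : Set (Site d)) := by
  classical
  have hempty : ((↑(edgeBoundary (zdGraph d) H) : Set (Sym2 (Site d))) ∩ ω) = ∅ := by
    rwa [openEdgeBoundaryCard, Set.ncard_eq_zero ((Finset.finite_toSet _).inter_of_left ω)] at h0
  have hclosed : ∀ ⦃a b : Site d⦄, a ∈ (↑H : Set (Site d)) → (openGraph ω).Adj a b →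
      b ∈ (↑H : Set (Site d)) := by
    intro a b ha hab
    rw [openGraph_adj] at hab
    by_contra hb
    have hmem : s(a, b) ∈ ((↑(edgeBoundary (zdGraph d) H) : Set (Sym2 (Site d))) ∩ ω) := by
      refine ⟨?_, hab.1⟩
      rw [Finset.mem_coe, mem_edgeBoundary_iff]
      exact ⟨hω hab.1, ⟨a, ha, Sym2.mem_mk_left a b⟩, ⟨b, hb, Sym2.mem_mk_right a b⟩⟩
    rw [hempty] at hmem
    exact hmem
  rintro x ⟨p⟩
  exact support_subset_of_adj_closed hclosed p (Finset.mem_coe.2 hH.1) x p.end_mem_support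

/-- For `ω ⊆ E(ℤ^d)`: a valid subgraph with no open boundary edge IS the cluster, `↑H = C(0)`.
[cite: CerfDembin2020, §2 (∂° C(0) = ∅)] -/
theorem IsValidSubgraph.coe_eq_openCluster_of_openEdgeBoundaryCard_eq_zero
    {ω : BondConfig (Site d)} (hω : ω ⊆ (zdGraph d).edgeSet) {H : Finset (Site d)}
    (hH : IsValidSubgraph d ω H) (h0 : openEdgeBoundaryCard d ω H = 0) :
    (↑H : Set (Site d)) = openCluster ω 0 :=
  Set.Subset.antisymm hH.subset_openCluster
    (hH.openCluster_subset_of_openEdgeBoundaryCard_eq_zero hω h0)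

/-- For `ω ⊆ E(ℤ^d)`: if `C(0)` is infinite, every valid subgraph has at least one open boundary
edge (contrapositive of the previous lemma). [cite: CerfDembin2020, §2 (∂° C(0) = ∅)] -/
theorem IsValidSubgraph.one_le_openEdgeBoundaryCard_of_infinite
    {ω : BondConfig (Site d)} (hω : ω ⊆ (zdGraph d).edgeSet) (hinf : (openCluster ω 0).Infinite)
    {H : Finset (Site d)} (hH : IsValidSubgraph d ω H) : 1 ≤ openEdgeBoundaryCard d ω H := by
  by_contra h
  have h0 : openEdgeBoundaryCard d ω H = 0 := by omega
  have heq := hH.coe_eq_openCluster_of_openEdgeBoundaryCard_eq_zero hω h0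
  exact hinf (by rw [← heq]; exact H.finite_toSet)

end Valid

/-! ## §2 Counting boundary edges -/

section Counting

/-- `|∂ H| ≤ 2d |H|` in `ℤ^d`: every boundary edge touches `H`, and a site has `2d` incident
edges. [folklore] -/
theorem card_edgeBoundary_zdGraph_le (H : Finset (Site d)) :
    (edgeBoundary (zdGraph d) H).card ≤ 2 * d * H.card := by
  calc (edgeBoundary (zdGraph d) H).card
      ≤ (edgesTouching (zdGraph d) H).card :=
        Finset.card_le_card (by rw [edgeBoundary]; exact Finset.sdiff_subset)
    _ ≤ ∑ x ∈ H, ((zdGraph d).incidenceFinset x).card := by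
        rw [edgesTouching]; exact Finset.card_biUnion_le
    _ = ∑ _x ∈ H, 2 * d := Finset.sum_congr rfl fun x _ => by
        rw [SimpleGraph.card_incidenceFinset_eq_degree,
          ← SimpleGraph.card_neighborFinset_eq_degree]
        convert card_neighborFinset_zdGraph_holds (d := d) x
    _ = 2 * d * H.card := by rw [Finset.sum_const, smul_eq_mul, mul_comm]

/-- `|∂° H| ≤ |∂ H|`: the open boundary edges are boundary edges.
[cite: CerfDembin2020, §1 (∂_𝒢 A)] -/
theorem openEdgeBoundaryCard_le_card (ω : BondConfig (Site d)) (H : Finset (Site d)) :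
    openEdgeBoundaryCard d ω H ≤ (edgeBoundary (zdGraph d) H).card := by
  rw [openEdgeBoundaryCard, ← Set.ncard_coe_finset (edgeBoundary (zdGraph d) H)]
  exact Set.ncard_inter_le_ncard_left _ _ (Finset.finite_toSet _)

/-- `|∂° H| ≤ 2d |H|`. [cite: CerfDembin2020, §2 (|∂° C_l| ≤ 2d |A_{l+1}|)] -/
theorem openEdgeBoundaryCard_le (ω : BondConfig (Site d)) (H : Finset (Site d)) :
    openEdgeBoundaryCard d ω H ≤ 2 * d * H.card :=
  (openEdgeBoundaryCard_le_card ω H).trans (card_edgeBoundary_zdGraph_le H)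

end Counting

/-! ## §3 The profile is an attained minimum over a finite set of ratios -/

section Profile

/-- The set of competing ratios `|∂° H| / |H|` (valid `H`, `0 < |H| ≤ n^d`) is finite: numerator
`≤ 2d n^d` and denominator `≤ n^d` are bounded natural numbers.
[cite: Dembin2020, §1 (definition of φ_n and of 𝒢_n)] -/
theorem anchoredProfile_ratioSet_finite (n : ℕ) (ω : BondConfig (Site d)) :
    {r : ℝ | ∃ H : Finset (Site d), IsValidSubgraph d ω H ∧ 0 < H.card ∧ H.card ≤ n ^ d ∧
      r = (openEdgeBoundaryCard d ω H : ℝ) / H.card}.Finite := by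
  refine (((Finset.range (2 * d * n ^ d + 1) ×ˢ Finset.range (n ^ d + 1)).finite_toSet.image
    (fun q : ℕ × ℕ => (q.1 : ℝ) / q.2)).subset ?_)
  rintro r ⟨H, -, -, hn, rfl⟩
  refine ⟨(openEdgeBoundaryCard d ω H, H.card), ?_, rfl⟩
  simp only [Finset.coe_product, Set.mem_prod, Finset.mem_coe, Finset.mem_range]
  exact ⟨Nat.lt_succ_of_le ((openEdgeBoundaryCard_le ω H).trans (Nat.mul_le_mul_left _ hn)),
    Nat.lt_succ_of_le hn⟩

/-- The set of competing ratios is bounded below by `0`.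
[cite: Dembin2020, §1 (definition of φ_n and of 𝒢_n)] -/
theorem anchoredProfile_ratioSet_bddBelow (n : ℕ) (ω : BondConfig (Site d)) :
    BddBelow {r : ℝ | ∃ H : Finset (Site d), IsValidSubgraph d ω H ∧ 0 < H.card ∧
      H.card ≤ n ^ d ∧ r = (openEdgeBoundaryCard d ω H : ℝ) / H.card} :=
  ⟨0, fun _ ⟨_, _, _, _, hr⟩ => hr ▸ div_nonneg (Nat.cast_nonneg _) (Nat.cast_nonneg _)⟩

/-- For `n ≥ 1` the set of competing ratios is nonempty (`H = {0}` competes).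
[cite: Dembin2020, §1 (definition of φ_n and of 𝒢_n)] -/
theorem anchoredProfile_ratioSet_nonempty {n : ℕ} (hn : 1 ≤ n) (ω : BondConfig (Site d)) :
    {r : ℝ | ∃ H : Finset (Site d), IsValidSubgraph d ω H ∧ 0 < H.card ∧ H.card ≤ n ^ d ∧
      r = (openEdgeBoundaryCard d ω H : ℝ) / H.card}.Nonempty :=
  ⟨_, {0}, isValidSubgraph_singleton d ω, by simp, by simpa using Nat.one_le_pow d n hn, rfl⟩

/-- **`φ̂_n ≤` every competing ratio**: for a valid `H` with `0 < |H| ≤ n^d`,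
`φ̂_n ≤ |∂° H| / |H|`. [cite: CerfDembin2020, §1 (definition of φ̂_n)] -/
theorem anchoredProfile_le_div {n : ℕ} {ω : BondConfig (Site d)} {H : Finset (Site d)}
    (hH : IsValidSubgraph d ω H) (hn : H.card ≤ n ^ d) :
    anchoredProfile d n ω ≤ (openEdgeBoundaryCard d ω H : ℝ) / H.card :=
  csInf_le (anchoredProfile_ratioSet_bddBelow n ω) ⟨H, hH, hH.card_pos, hn, rfl⟩

/-- **The minimum is attained** ([Dembin2020, §1]: "let `𝒢_n` be the set of the valid subgraphs
that achieve the infimum in `φ_n`" — nonempty for `n ≥ 1`): some valid `H` with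
`0 < |H| ≤ n^d` has `φ̂_n = |∂° H| / |H|`. [cite: Dembin2020, §1 (definition of φ_n and of 𝒢_n)] -/
theorem exists_isValidSubgraph_anchoredProfile_eq {n : ℕ} (hn : 1 ≤ n) (ω : BondConfig (Site d)) :
    ∃ H : Finset (Site d), IsValidSubgraph d ω H ∧ 0 < H.card ∧ H.card ≤ n ^ d ∧
      anchoredProfile d n ω = (openEdgeBoundaryCard d ω H : ℝ) / H.card :=
  (anchoredProfile_ratioSet_nonempty hn ω).csInf_mem (anchoredProfile_ratioSet_finite n ω)

/-- `φ̂_n ≥ 0`. [cite: CerfDembin2020, §1 (definition of φ̂_n)] -/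
theorem anchoredProfile_nonneg (n : ℕ) (ω : BondConfig (Site d)) : 0 ≤ anchoredProfile d n ω :=
  Real.sInf_nonneg fun _ ⟨_, _, _, _, hr⟩ => hr ▸ div_nonneg (Nat.cast_nonneg _) (Nat.cast_nonneg _)

/-- A lower bound valid for every competitor is a lower bound for `φ̂_n` (`n ≥ 1`).
[cite: CerfDembin2020, §1 (definition of φ̂_n)] -/
theorem le_anchoredProfile_of_forall {n : ℕ} (hn : 1 ≤ n) {ω : BondConfig (Site d)} {c : ℝ}
    (h : ∀ H : Finset (Site d), IsValidSubgraph d ω H → H.card ≤ n ^ d →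
      c ≤ (openEdgeBoundaryCard d ω H : ℝ) / H.card) :
    c ≤ anchoredProfile d n ω := by
  obtain ⟨H, hH, -, hcard, heq⟩ := exists_isValidSubgraph_anchoredProfile_eq hn ω
  rw [heq]
  exact h H hH hcard

/-- `φ̂_n ≤ 2d` for `n ≥ 1` (compare with `H = {0}`, or use `|∂° H| ≤ 2d |H|`).
[cite: CerfDembin2020, §1 (definition of φ̂_n)] -/
theorem anchoredProfile_le_two_mul {n : ℕ} (hn : 1 ≤ n) (ω : BondConfig (Site d)) :
    anchoredProfile d n ω ≤ 2 * d := by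
  have h1 : ({0} : Finset (Site d)).card ≤ n ^ d := by simpa using Nat.one_le_pow d n hn
  refine (anchoredProfile_le_div (isValidSubgraph_singleton d ω) h1).trans ?_
  rw [Finset.card_singleton, Nat.cast_one, div_one]
  have h := openEdgeBoundaryCard_le ω ({0} : Finset (Site d))
  rw [Finset.card_singleton, mul_one] at h
  exact_mod_cast h

/-- `φ̂_n` is non-increasing in `n ≥ 1` (more competitors). [cite: CerfDembin2020, §1 (definition of φ̂_n)] -/
theorem anchoredProfile_antitone {m n : ℕ} (hm : 1 ≤ m) (hmn : m ≤ n) (ω : BondConfig (Site d)) :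
    anchoredProfile d n ω ≤ anchoredProfile d m ω := by
  refine csInf_le_csInf (anchoredProfile_ratioSet_bddBelow n ω)
    (anchoredProfile_ratioSet_nonempty hm ω) ?_
  rintro r ⟨H, hH, h0, hcard, rfl⟩
  exact ⟨H, hH, h0, hcard.trans (Nat.pow_le_pow_left hmn d), rfl⟩

/-- **`φ̂_n = 0` for a small cluster** ([CerfDembin2020, §1]: "if `0` is not connected to
`∂[-n/2,n/2]^d` by a `p`-open path, then `|C(0)| < n^d` and taking `H = C(0)`, we see that
`φ̂_n(p)` is equal to `0`"): if `C(0)` is finite with `|C(0)| ≤ n^d` then `φ̂_n = 0`.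
[cite: CerfDembin2020, §1 (φ̂_n = 0 when C(0) is small)] -/
theorem anchoredProfile_eq_zero_of_finite {n : ℕ} {ω : BondConfig (Site d)}
    (hC : (openCluster ω 0).Finite) (hn : hC.toFinset.card ≤ n ^ d) :
    anchoredProfile d n ω = 0 := by
  refine le_antisymm ?_ (anchoredProfile_nonneg n ω)
  have h := anchoredProfile_le_div (isValidSubgraph_toFinset_openCluster hC) hn
  rwa [openEdgeBoundaryCard_toFinset_openCluster hC, Nat.cast_zero, zero_div] at h

/-- **`φ̂_n ≥ n^{-d}` on `{C(0) infinite}`** (`ω ⊆ E(ℤ^d)`, `n ≥ 1`): every competitor has at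
least one open boundary edge and at most `n^d` vertices. With the previous lemma this is the
dichotomy behind "`lim n φ̂_n(p) = θ(p) δ_{φ(p)} + (1 - θ(p)) δ_0`" of [CerfDembin2020, §1].
[cite: CerfDembin2020, §1 (φ̂_n and the event {0 ∈ C_∞})] -/
theorem inv_pow_le_anchoredProfile_of_infinite {n : ℕ} (hn : 1 ≤ n) {ω : BondConfig (Site d)}
    (hω : ω ⊆ (zdGraph d).edgeSet) (hinf : (openCluster ω 0).Infinite) :
    ((n : ℝ) ^ d)⁻¹ ≤ anchoredProfile d n ω := by
  refine le_anchoredProfile_of_forall hn fun H hH hcard => ?_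
  have h1 : (1 : ℝ) ≤ openEdgeBoundaryCard d ω H := by
    exact_mod_cast hH.one_le_openEdgeBoundaryCard_of_infinite hω hinf
  have hpos : (0 : ℝ) < H.card := by exact_mod_cast hH.card_pos
  have hcard' : (H.card : ℝ) ≤ (n : ℝ) ^ d := by exact_mod_cast hcard
  rw [inv_eq_one_div]
  calc (1 : ℝ) / (n : ℝ) ^ d ≤ 1 / H.card := one_div_le_one_div_of_le hpos hcard'
    _ ≤ (openEdgeBoundaryCard d ω H : ℝ) / H.card := div_le_div_of_nonneg_right h1 hpos.le

/-- In particular `φ̂_n > 0` on `{C(0) infinite}` (`ω ⊆ E(ℤ^d)`, `n ≥ 1`).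
[cite: CerfDembin2020, §1 (φ̂_n and the event {0 ∈ C_∞})] -/
theorem anchoredProfile_pos_of_infinite {n : ℕ} (hn : 1 ≤ n) {ω : BondConfig (Site d)}
    (hω : ω ⊆ (zdGraph d).edgeSet) (hinf : (openCluster ω 0).Infinite) :
    0 < anchoredProfile d n ω :=
  lt_of_lt_of_le (inv_pos.2 (pow_pos (Nat.cast_pos.2 hn) d))
    (inv_pow_le_anchoredProfile_of_infinite hn hω hinf)

/-- `P_p`-almost surely the configuration is a lattice configuration, so the two previous lemmas
apply a.s.: on `{C(0) infinite}`, `φ̂_n ≥ n^{-d}` for every `n ≥ 1`.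
[cite: CerfDembin2020, §1 (φ̂_n and the event {0 ∈ C_∞})] -/
theorem ae_inv_pow_le_anchoredProfile (p : unitInterval) :
    ∀ᵐ ω ∂(bondPercolation (zdGraph d) p), (openCluster ω 0).Infinite →
      ∀ n : ℕ, 1 ≤ n → ((n : ℝ) ^ d)⁻¹ ≤ anchoredProfile d n ω := by
  have hsub : ∀ᵐ ω ∂(bondPercolation (zdGraph d) p), ω ⊆ (zdGraph d).edgeSet :=
    ProbabilityTheory.setBernoulli_ae_subset
  filter_upwards [hsub] with ω hω hinf n hn
  exact inv_pow_le_anchoredProfile_of_infinite hn hω hinf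

end Profile

end Literature.Probability.Percolation
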